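import Summits.CriticalPhenomena.PercolationContinuityZ3.Theorems.PercNearOneGluingNoHeavyRsw3WMSFBranches
import Literature.Barriers.CriticalPhenomena.AmenableInvariantPercolationProfile
import HarnessLib

/-!
# RSW3 lane (P2, gen 30): THE WIRED MINIMAL SPANNING FOREST, V — **NO BRANCHING: almost surely every vertex of `ℤ^d` has AT MOST ONE trunk child**
# (the first mass transport of Lyons–Peres 2016 Thm. 11.12 on `ℤ^d`: every component of `𝔉_w(ℤ^d)` has at most two ends)

builds on p205010 (kernel theorem, internal audit signed; external expert review pending) — used through gen 29's a.s. backbones (files XXXVI–XXXVII).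

Cell `prim-rsw3`, prover seat `prim-rsw3-p2` (gen 30), memo `run/shared/lean/prim/rsw3/P2-RSWLITE.md` §37.  Support file
(`--supports stmt-CriticalPhenomena-4575`); no definitions, no named facts, no sorries.  Fifth file of the programme "every component of `𝔉_w(ℤ^d)` has
EXACTLY ONE end".  Orient `𝔉_w` toward the canonical end (file I: `par v = R_v(1)`); a TRUNK vertex is one with infinitely many descendants, a trunk CHILD of
`o` is a trunk vertex `w` with `par w = o`.  In the measurable vocabulary of files III–IV: `w` is a trunk child of `o` iff `ξ(w, o; T(w)) ∧ ξ(o, w; 𝔉_w)`.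

* §1 (deterministic; infinite connected locally finite graph, injective labels, outlets beyond every time and a unique backbone at every vertex):
  `encard_rootBranch_le_one` — at most one `y` with `ξ(o, y; T(o))` (namely `R_o(1)`); **`one_le_encard_trunkChildren`** — a trunk vertex has a trunk
  child (file II `exists_trunk_child`, translated through file IV).
* §2 **`ae_encard_trunkChildren_le_one`** (`ℤ^d`, `d ≥ 2`): almost surely, for every `o`, `#{w : ξ(w, o; T(w)) ∧ ξ(o, w; 𝔉_w)} ≤ 1`.  PROOF (Lyons–Peres §8.1,
  mass transport): `F(w, v; U) := 1[U injective ∧ ξ(w, v; T_U(w)) ∧ ξ(v, w; 𝔉_w(U))]` is measurable and invariant under the diagonal action of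
  `Aut(ℤ^d)` on vertices and labels (file III); the mass-transport principle on the unimodular transitive graph `ℤ^d`
  (`Literature.Barriers.CriticalPhenomena.lintegral_tsum_eq_of_isGraphUnimodular`, `isGraphUnimodular_zdGraph`, `labelMeasure_map_actLabels`) gives
  `E Σ_v F(o, v) = E Σ_w F(w, o)`; the mass sent is `1[o trunk] ≤ 1` and the mass received is the number of trunk children `≥ 1[o trunk]` (§1), so they
  are a.s. EQUAL (`ae_eq_of_ae_le_of_lintegral_le`), whence `≤ 1`.

References: R. Lyons, Y. Peres, *Probability on Trees and Networks* (2016), §8.1 (mass-transport principle), Thm. 11.11–11.12 [LyonsPeres2016];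
R. Lyons, Y. Peres, O. Schramm, Ann. Probab. 34 (2006) Thm. 3.12 [LyonsPeresSchramm2006]; I. Benjamini, R. Lyons, Y. Peres, O. Schramm, GAFA 9 (1999) §3
[BenjaminiLyonsPeresSchramm1999b].
-/

noncomputable section

namespace Summit.CriticalPhenomena.PercolationContinuityZ3.Theorems.Rsw3

open Finset Filter MeasureTheory Literature.Probability.LatticeModels Literature.Probability.Percolation
open Literature.Probability.Percolation.Invasion Literature.Barriers.CriticalPhenomena
open scoped ENNReal

section General

variable {V : Type*} [DecidableEq V] {G : SimpleGraph V} [G.LocallyFinite]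

/-! ## §1 Deterministic consequences of files I–IV on a good label field -/

/-- **At most one infinite branch at the root of an invasion tree**: `{y : ξ(o, y; T(o))} ⊆ {R_o(1)}` (file IV). [cite: LyonsPeres2016, Thm. 11.12 (proof)] -/
theorem encard_rootBranch_le_one [Infinite V] (hG : G.Preconnected) {U : Sym2 V → ℝ} {o : V}
    (hout : ∀ k, ∃ m, k ≤ m ∧ IsOutlet G U o m)
    (hray : ∃ R : ℕ → V, Function.Injective R ∧ R 0 = o ∧ ∀ i, (tree G U o).Adj (R i) (R (i + 1))) :
    {y | InfBranch (treeEdges G U o) o y}.encard ≤ 1 := by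
  obtain ⟨R, hR, hR0, hRadj⟩ := hray
  have : {y | InfBranch (treeEdges G U o) o y} = {R 1} :=
    Set.ext fun y => by rw [Set.mem_setOf_eq, infBranch_treeEdges_iff_eq_ray_one hG hout hR hR0 hRadj, Set.mem_singleton_iff]
  rw [this, Set.encard_singleton]

/-- `𝔉_w(U)` is locally finite (a subgraph of the locally finite `G`). [folklore] -/
theorem finite_neighborSet_openGraph_wmsf (U : Sym2 V → ℝ) (v : V) : ((openGraph (wmsf G U)).neighborSet v).Finite :=
  (G.neighborSet v).toFinite.subset fun _ hw => fromEdgeSet_wmsf_le U hw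

/-- **A trunk vertex has a trunk child, in the measurable vocabulary**: if `ξ(o, y; T(o))` and `ξ(y, o; 𝔉_w)` (i.e. `y = par o` and `o` is a trunk vertex), then
some `w` satisfies `ξ(w, o; T(w)) ∧ ξ(o, w; 𝔉_w)` (infinite connected locally finite graph, injective labels, outlets beyond every time and a unique backbone
at every vertex — all a.s. on `ℤ^d`). [cite: LyonsPeres2016, Thm. 11.12 (proof: the trunk)] -/
theorem one_le_encard_trunkChildren [Infinite V] (hG : G.Preconnected) {U : Sym2 V → ℝ} (hU : Function.Injective U)
    (hout : ∀ v : V, ∀ k, ∃ m, k ≤ m ∧ IsOutlet G U v m)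
    (hray : ∀ v : V, ∃! R : ℕ → V, Function.Injective R ∧ R 0 = v ∧ ∀ i, (tree G U v).Adj (R i) (R (i + 1)))
    {o y : V} (hy : InfBranch (treeEdges G U o) o y) (ho : InfBranch (wmsf G U) y o) :
    1 ≤ {w | InfBranch (treeEdges G U w) w o ∧ InfBranch (wmsf G U) o w}.encard := by
  classical
  -- the backbone field and its properties (files I, XXXIX)
  have hex : ∀ v : V, ∃ R : ℕ → V, Function.Injective R ∧ R 0 = v ∧ ∀ i, (tree G U v).Adj (R i) (R (i + 1)) := fun v => (hray v).exists
  choose R hR hR0 hRadj using hex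
  have hUi : Set.InjOn U G.edgeSet := hU.injOn
  have hF : (openGraph (wmsf G U)).IsAcyclic := wmsf_isAcyclic U
  have hadjF : ∀ v i, (openGraph (wmsf G U)).Adj (R v i) (R v (i + 1)) := fun v i => tree_le_fromEdgeSet_wmsf hUi v (hRadj v i)
  have hex' : ∀ v : V, ∃ R : ℕ → V, Function.Injective R ∧ R 0 = v ∧ ∀ i, (tree G U v).Adj (R i) (R (i + 1)) := fun v => (hray v).exists
  have hcoh : ∀ v i k, R (R v i) k = R v (i + k) := fun v i k =>
    ray_coherent hG hU hout hex' (hR v) (hR0 v) (hRadj v) i (hR _) (hR0 _) (hRadj _) k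
  have htail : ∀ x y : V, (openGraph (wmsf G U)).Adj x y → ∃ a b, ∀ k, R x (a + k) = R y (b + k) := by
    intro x z hxz
    rw [openGraph_adj] at hxz
    exact rays_tail_equivalent_of_mem_wmsf hG hU hxz.1 (hout x) (hR x) (hR0 x) (hRadj x) (hR z) (hRadj z)
  haveI : (openGraph (wmsf G U)).LocallyFinite := fun v => @Fintype.ofFinite _ (finite_neighborSet_openGraph_wmsf U v).to_subtype
  -- `y = par o` and `o` is a trunk vertex
  have hy' : y = R o 1 := (infBranch_treeEdges_iff_eq_ray_one hG (hout o) (hR o) (hR0 o) (hRadj o) y).1 hy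
  subst hy'
  have htrunk : {u | ∃ i, R u i = o}.Infinite := (infBranch_parent_iff_trunk hF hR0 hR hadjF hcoh htail o).1 ho
  obtain ⟨w, -, hw1, hw⟩ := exists_trunk_child hR0 hadjF hcoh htrunk
  have hw_mem : w ∈ {w | InfBranch (treeEdges G U w) w o ∧ InfBranch (wmsf G U) o w} := by
    refine ⟨(infBranch_treeEdges_iff_eq_ray_one hG (hout w) (hR w) (hR0 w) (hRadj w) o).2 hw1.symm, ?_⟩
    rw [← hw1]
    exact (infBranch_parent_iff_trunk hF hR0 hR hadjF hcoh htail w).2 hw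
  rw [Set.one_le_encard_iff_nonempty]
  exact ⟨w, hw_mem⟩

end General

/-! ## §2 `ℤ^d`: no branching, by the mass-transport principle -/

variable {d : ℕ}

/-- The sum of the indicator transport over the second vertex is the cardinality of the corresponding set. [folklore] -/
theorem tsum_ite_eq_encard {W : Type*} (P : W → Prop) [DecidablePred P] :
    (∑' w, (if P w then (1 : ℝ≥0∞) else 0)) = ({w | P w}.encard : ℝ≥0∞) := by
  classical
  have : (fun w => (if P w then (1 : ℝ≥0∞) else 0)) = {w | P w}.indicator fun _ => 1 := by
    ext w; simp only [Set.indicator_apply, Set.mem_setOf_eq]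
  rw [this, tsum_indicator_const, mul_one]

/-- **NO BRANCHING (`ℤ^d`, `d ≥ 2`): almost surely, every vertex has AT MOST ONE trunk child** — for every `o`,
`#{w : ξ(w, o; T(w)) ∧ ξ(o, w; 𝔉_w)} ≤ 1` — by the mass-transport principle applied to `F(w, v; U) = 1[U injective ∧ ξ(w, v; T_U(w)) ∧ ξ(v, w; 𝔉_w(U))]`:
mass out `= 1[o trunk] ≤` mass in `= #`trunk children, with equal expectations.  (Equivalently: every component of `𝔉_w(ℤ^d)` has at most two ends; Lyons–Peres
Thm. 11.11 for `ℤ^d`.) [cite: LyonsPeres2016, §8.1 (mass-transport principle) and Thm. 11.11–11.12] [cite: LyonsPeresSchramm2006, Thm. 3.12] -/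
theorem ae_encard_trunkChildren_le_one (hd : 2 ≤ d) :
    ∀ᵐ U ∂(labelMeasure (Site d)), ∀ o : Site d,
      {w | InfBranch (treeEdges (zdGraph d) U w) w o ∧ InfBranch (wmsf (zdGraph d) U) o w}.encard ≤ 1 := by
  classical
  haveI : Nonempty (Fin d) := ⟨⟨0, by omega⟩⟩
  haveI : Infinite (Site d) := Pi.infinite_of_right
  haveI : IsProbabilityMeasure (labelMeasure (Site d)) := isProbabilityMeasure_labelMeasure _
  set G := zdGraph d with hGdef
  -- the transport
  set F : Site d → Site d → (Sym2 (Site d) → ℝ) → ℝ≥0∞ := fun w v U =>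
    if Function.Injective U ∧ InfBranch (treeEdges G U w) w v ∧ InfBranch (wmsf G U) v w then 1 else 0 with hFdef
  have hFmeas : ∀ w v, Measurable (F w v) := by
    intro w v
    refine Measurable.ite (measurableSet_setOf.2 ?_) measurable_const measurable_const
    exact (measurableSet_setOf.1 measurableSet_injective).and
      ((measurableSet_setOf.1 (measurableSet_infBranch_treeEdges (G := G) w w v)).and
        (measurableSet_setOf.1 (measurableSet_infBranch_wmsf (G := G) v w)))
  have hFinv : ∀ (γ : G ≃g G) (w v : Site d) (U : Sym2 (Site d) → ℝ), F (γ w) (γ v) (actLabels γ U) = F w v U := by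
    intro γ w v U
    by_cases hU : Function.Injective U
    · simp only [hFdef, injective_actLabels_iff, infBranch_treeEdges_actLabels_iff γ hU, infBranch_wmsf_actLabels_iff]
    · have hU' : ¬ Function.Injective (actLabels γ U) := by rwa [injective_actLabels_iff]
      simp only [hFdef, hU, hU', false_and, if_false]
  -- the mass-transport principle on `ℤ^d`
  have hMTP : ∀ o : Site d, ∫⁻ U, ∑' v, F o v U ∂(labelMeasure (Site d)) = ∫⁻ U, ∑' w, F w o U ∂(labelMeasure (Site d)) :=
    fun o => lintegral_tsum_eq_of_isGraphUnimodular G (zdGraph_connected d) (isGraphTransitive_zdGraph d) (isGraphUnimodular_zdGraph d)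
      (labelMeasure (Site d)) (fun γ => actLabels γ) (fun γ => measurable_actLabels γ) (fun γ => labelMeasure_map_actLabels γ) hFmeas hFinv o
  -- both masses as cardinalities
  have hout_eq : ∀ o U, (∑' v, F o v U) = ({v | Function.Injective U ∧ InfBranch (treeEdges G U o) o v ∧ InfBranch (wmsf G U) v o}.encard : ℝ≥0∞) :=
    fun o U => tsum_ite_eq_encard _
  have hin_eq : ∀ o U, (∑' w, F w o U) = ({w | Function.Injective U ∧ InfBranch (treeEdges G U w) w o ∧ InfBranch (wmsf G U) o w}.encard : ℝ≥0∞) :=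
    fun o U => tsum_ite_eq_encard _
  -- the a.s. good event
  have hgood := (Literature.Barriers.CriticalPhenomena.ae_injective_labelMeasure (V := Site d)).and (ae_forall_root_existsUnique_ray hd)
  refine ae_all_iff.2 fun o => ?_
  -- mass out ≤ mass in, a.s.; mass out ≤ 1, a.s.
  have hle : ∀ᵐ U ∂(labelMeasure (Site d)), (∑' v, F o v U) ≤ ∑' w, F w o U := by
    filter_upwards [hgood] with U hU
    obtain ⟨hUinj, hall⟩ := hU
    rw [hout_eq, hin_eq]
    by_cases hne : {v | Function.Injective U ∧ InfBranch (treeEdges G U o) o v ∧ InfBranch (wmsf G U) v o}.Nonempty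
    · obtain ⟨y, -, hy, hyo⟩ := hne
      have hsub : {v | Function.Injective U ∧ InfBranch (treeEdges G U o) o v ∧ InfBranch (wmsf G U) v o} ⊆
          {y | InfBranch (treeEdges G U o) o y} := fun v hv => hv.2.1
      have h1 : ({v | Function.Injective U ∧ InfBranch (treeEdges G U o) o v ∧ InfBranch (wmsf G U) v o}.encard : ℝ≥0∞) ≤ 1 := by
        have h := encard_rootBranch_le_one zdGraph_preconnected_holds (hall o).1 (hall o).2.exists
        exact_mod_cast (Set.encard_le_encard hsub).trans h
      have h2 : (1 : ℝ≥0∞) ≤ ({w | Function.Injective U ∧ InfBranch (treeEdges G U w) w o ∧ InfBranch (wmsf G U) o w}.encard : ℝ≥0∞) := by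
        have h := one_le_encard_trunkChildren zdGraph_preconnected_holds hUinj (fun v => (hall v).1) (fun v => (hall v).2) hy hyo
        have h' : {w | InfBranch (treeEdges G U w) w o ∧ InfBranch (wmsf G U) o w} ⊆
            {w | Function.Injective U ∧ InfBranch (treeEdges G U w) w o ∧ InfBranch (wmsf G U) o w} := fun w hw => ⟨hUinj, hw⟩
        exact_mod_cast h.trans (Set.encard_le_encard h')
      exact h1.trans h2
    · rw [Set.not_nonempty_iff_eq_empty.1 hne, Set.encard_empty]
      simp
  have hle_one : ∀ᵐ U ∂(labelMeasure (Site d)), (∑' v, F o v U) ≤ 1 := by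
    filter_upwards [hgood] with U hU
    rw [hout_eq]
    have hsub : {v | Function.Injective U ∧ InfBranch (treeEdges G U o) o v ∧ InfBranch (wmsf G U) v o} ⊆
        {y | InfBranch (treeEdges G U o) o y} := fun v hv => hv.2.1
    have h := encard_rootBranch_le_one zdGraph_preconnected_holds (hU.2 o).1 (hU.2 o).2.exists
    exact_mod_cast (Set.encard_le_encard hsub).trans h
  have hfin : ∫⁻ U, ∑' v, F o v U ∂(labelMeasure (Site d)) ≠ ∞ := by
    refine ne_top_of_le_ne_top (by simp) (?_ : _ ≤ ∫⁻ _, (1 : ℝ≥0∞) ∂(labelMeasure (Site d)))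
    exact lintegral_mono_ae hle_one
  have hmeas_in : Measurable fun U => ∑' w, F w o U := by
    have : (fun U => ∑' w, F w o U) = fun U => ⨆ s : Finset (Site d), ∑ w ∈ s, F w o U :=
      funext fun U => ENNReal.tsum_eq_iSup_sum
    rw [this]
    exact Measurable.iSup fun s => Finset.measurable_sum s fun w _ => hFmeas w o
  have heq := ae_eq_of_ae_le_of_lintegral_le hle hfin hmeas_in.aemeasurable (hMTP o).symm.le
  filter_upwards [heq, hle_one, hgood] with U hU h1 hg
  have h : (∑' w, F w o U) ≤ 1 := hU ▸ h1
  rw [hin_eq] at h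
  have h' : {w | InfBranch (treeEdges G U w) w o ∧ InfBranch (wmsf G U) o w} ⊆
      {w | Function.Injective U ∧ InfBranch (treeEdges G U w) w o ∧ InfBranch (wmsf G U) o w} := fun w hw => ⟨hg.1, hw⟩
  exact_mod_cast (Set.encard_le_encard h').trans (by exact_mod_cast h)

end Summit.CriticalPhenomena.PercolationContinuityZ3.Theorems.Rsw3
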